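import Mathlib
import Summits.PneNP.PneNP.Theorems.Nc03AvoidResidualCoreCandCherry
import Summits.PneNP.PneNP.Theorems.Nc03AvoidResidualCoreReductionRankKit
import Summits.PneNP.PneNP.Theorems.Nc03AvoidResidualCoreCandMatchRungFP

/-!
# Route Nc03AvoidResidualCore, crux `CandStarReduction` (X₂) — the tangled-surplus solver, I: the program

Helper file for `stmt-PneNP-19963` (`Summit.PneNP.PneNP.Theses.Nc03AvoidResidualCore.CandStarReduction :
CandMatchAvoidLinearFP → CandAvoidLinearFP`, the ★-reduction of the cell memo pnp-ideate-p2
ROUND-3-ADDENDUM-B, Thm B.1; cell pnp-ideate, rung F-N1b). This file is the LIST-LEVEL PROGRAM of a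
polynomial-time avoider for pure-`CAND` instances with many TANGLED outputs (outputs sharing their head and a
data variable with another output), in a variant of Algorithm ★ chosen so that the only non-trivial
computation is the tree's `𝔽₂` span test `Nc03Reduction.inSpan`:

* (F1) `findPar` — a parallel pair (same head, same data pair) is killed by the pattern `1/0`;
* `cherryCands`, `greedy`, `cher` — a MAXIMAL family of pairwise disjoint CHERRIES with distinct apexes
  (a cherry at apex `u`: two outputs with the same head sharing the data variable `u`), found greedily;
  the pattern `y (first edge) ≠ y (second edge)` forces `x_u = 1` (`…CandCherry.apex_eq_true_of_cherry`);
* `covL` — the outputs with a forced data variable: on them `y` is AFFINE in the unforced variables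
  (`…CandCherry.eval_of_data_true₁/₂`), with columns `cols` and constant `bet`;
* `kers` — the flip sets (nothing, a covered non-cherry output, a whole cherry) spanning the patterns
  compatible with the forcing; `pick` — the first flip set whose pattern leaves the column space
  (span test); `mainOut` / `starOut` — the answer.

Plus the generic facts about the greedy fold (`greedy_sublist`, `greedy_pairwise`, `exists_clash_of_mem`).
Reading lemmas on genuine instances, correctness (for `2n+1 ≤ #tangled`) and polynomial time are the sequel
files `…CandStarRead`, `…CandStarCover`, `…CandStarAffine`, `…CandStarMain`, `…CandStarFP`.

Restricted-model (NC⁰₃) range-avoidance rung F-N1b of the PneNP frontier ladder; no bearing on P vs NP.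
-/

set_option linter.dupNamespace false -- `Summit.PneNP.PneNP.…`: summit = sub-problem name (D-0017 single-conjunct layout)

namespace Summit.PneNP.PneNP.Theorems.Nc03CandStar

open Literature.Computability.Complexity Nc03Reduction
open Summit.PneNP.PneNP.Theorems.Nc03AvoidResidualCoreCandFewHeadsRungFP (tri)

/-! ## The program -/

/-- All pairs of output indices below `M`. -/
def prs (M : ℕ) : List (ℕ × ℕ) := (List.range M).product (List.range M)

/-- (F1) test: distinct outputs, equal heads, equal unordered data pairs. -/
def parB (L : List (ℕ × ℕ × ℕ)) (p : ℕ × ℕ) : Bool :=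
  !decide (p.1 = p.2) && decide ((tri L p.1).1 = (tri L p.2).1) &&
    (decide ((tri L p.1).2.1 = (tri L p.2).2.1) && decide ((tri L p.1).2.2 = (tri L p.2).2.2) ||
      decide ((tri L p.1).2.1 = (tri L p.2).2.2) && decide ((tri L p.1).2.2 = (tri L p.2).2.1))

/-- (F1) search: the first parallel pair, if any. -/
def findPar (pr : PRaw) : Option (ℕ × ℕ) := (prs pr.2.1).find? (parB pr.2.2)

/-- Cherry test on an ordered pair: `p.1 < p.2`, equal heads, a common data variable. -/
def shareB (L : List (ℕ × ℕ × ℕ)) (p : ℕ × ℕ) : Bool :=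
  decide (p.1 < p.2) && decide ((tri L p.1).1 = (tri L p.2).1) &&
    (decide ((tri L p.1).2.1 = (tri L p.2).2.1) || decide ((tri L p.1).2.1 = (tri L p.2).2.2) ||
      decide ((tri L p.1).2.2 = (tri L p.2).2.1) || decide ((tri L p.1).2.2 = (tri L p.2).2.2))

/-- The apex (a common data variable) of a cherry pair. -/
def apexOf (L : List (ℕ × ℕ × ℕ)) (p : ℕ × ℕ) : ℕ :=
  if (tri L p.1).2.1 = (tri L p.2).2.1 ∨ (tri L p.1).2.1 = (tri L p.2).2.2 then (tri L p.1).2.1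
  else (tri L p.1).2.2

/-- The cherry candidates `(apex, first output, second output)`. -/
def cherryCands (pr : PRaw) : List (ℕ × ℕ × ℕ) :=
  ((prs pr.2.1).filter (shareB pr.2.2)).map fun p => (apexOf pr.2.2 p, p.1, p.2)

/-- Two cherries clash: equal apexes or a common output. -/
def clash (q c : ℕ × ℕ × ℕ) : Bool :=
  decide (q.1 = c.1) || decide (q.2.1 = c.2.1) || decide (q.2.1 = c.2.2) || decide (q.2.2 = c.2.1) ||
    decide (q.2.2 = c.2.2)

/-- Greedy step: keep a candidate iff it clashes with nothing kept so far. -/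
def gstep (acc : List (ℕ × ℕ × ℕ)) (c : ℕ × ℕ × ℕ) : List (ℕ × ℕ × ℕ) :=
  if acc.any (fun q => clash q c) then acc else acc ++ [c]

/-- The greedy fold. -/
def greedy (l : List (ℕ × ℕ × ℕ)) : List (ℕ × ℕ × ℕ) := l.foldl gstep []

/-- The chosen cherries of a raw pure instance: a maximal clash-free family. -/
def cher (pr : PRaw) : List (ℕ × ℕ × ℕ) := greedy (cherryCands pr)

/-- The forced variables (apexes of the chosen cherries). -/
def forcedL (ch : List (ℕ × ℕ × ℕ)) : List ℕ := ch.map fun q => q.1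

/-- Forced-variable test. -/
def isF (ch : List (ℕ × ℕ × ℕ)) (u : ℕ) : Bool := decide (u ∈ forcedL ch)

/-- The first edges of the chosen cherries (the pattern `σ` is their indicator). -/
def firstL (ch : List (ℕ × ℕ × ℕ)) : List ℕ := ch.map fun q => q.2.1

/-- All cherry edges. -/
def edgeL (ch : List (ℕ × ℕ × ℕ)) : List ℕ := ch.map (fun q => q.2.1) ++ ch.map fun q => q.2.2

/-- Covered-output test: a data variable is forced. -/
def covB (L : List (ℕ × ℕ × ℕ)) (ch : List (ℕ × ℕ × ℕ)) (o : ℕ) : Bool :=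
  isF ch (tri L o).2.1 || isF ch (tri L o).2.2

/-- The covered outputs. -/
def covL (pr : PRaw) (ch : List (ℕ × ℕ × ℕ)) : List ℕ := (List.range pr.2.1).filter (covB pr.2.2 ch)

/-- The base pattern `σ`: `1` exactly on the first cherry edges. -/
def sig (ch : List (ℕ × ℕ × ℕ)) (o : ℕ) : Bool := decide (o ∈ firstL ch)

/-- The affine constant `β` of a covered output: `[both data forced] ⊕ [head forced]`. -/
def bet (L : List (ℕ × ℕ × ℕ)) (ch : List (ℕ × ℕ × ℕ)) (o : ℕ) : Bool :=
  (isF ch (tri L o).2.1 && isF ch (tri L o).2.2) ^^ isF ch (tri L o).1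

/-- Column test: output `o` reads the (unforced) variable `v` linearly. -/
def colB (L : List (ℕ × ℕ × ℕ)) (ch : List (ℕ × ℕ × ℕ)) (v o : ℕ) : Bool :=
  decide ((tri L o).1 = v) || (decide ((tri L o).2.1 = v) && isF ch (tri L o).2.2) ||
    (decide ((tri L o).2.2 = v) && isF ch (tri L o).2.1)

/-- The column of variable `v` (as a list of covered outputs). -/
def colL (pr : PRaw) (ch : List (ℕ × ℕ × ℕ)) (v : ℕ) : List ℕ := (covL pr ch).filter (colB pr.2.2 ch v)

/-- The columns of the unforced variables. -/
def cols (pr : PRaw) (ch : List (ℕ × ℕ × ℕ)) : List (List ℕ) :=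
  ((List.range pr.1).filter fun v => !isF ch v).map (colL pr ch)

/-- The test vector of a flip set `S`: covered outputs where `σ ⊕ 𝟙_S ⊕ β = 1`. -/
def tvec (pr : PRaw) (ch : List (ℕ × ℕ × ℕ)) (S : List ℕ) : List ℕ :=
  (covL pr ch).filter fun o => (sig ch o ^^ decide (o ∈ S)) ^^ bet pr.2.2 ch o

/-- The flip sets: nothing, one covered non-cherry output, one whole cherry. -/
def kers (pr : PRaw) (ch : List (ℕ × ℕ × ℕ)) : List (List ℕ) :=
  [] :: ((((covL pr ch).filter fun o => !decide (o ∈ edgeL ch)).map fun o => [o]) ++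
    ch.map fun q => [q.2.1, q.2.2])

/-- The chosen flip set: the first whose test vector leaves the column space. -/
def pick (pr : PRaw) (ch : List (ℕ × ℕ × ℕ)) : List ℕ :=
  ((kers pr ch).find? fun S => !inSpan pr.2.1 (cols pr ch) (tvec pr ch S)).getD []

/-- The main answer, given the cherries: `σ ⊕ 𝟙_{pick}` on all outputs. -/
def mainOutW (pr : PRaw) (ch : List (ℕ × ℕ × ℕ)) : List Bool :=
  (List.range pr.2.1).map fun o => sig ch o ^^ decide (o ∈ pick pr ch)

/-- The main answer. -/
def mainOut (pr : PRaw) : List Bool := mainOutW pr (cher pr)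

/-- Dispatch on the (F1) search (one shared eliminator). -/
def starDispatch (pr : PRaw) (o : Option (ℕ × ℕ)) : List Bool :=
  match o with
  | some p => indic pr.2.1 [p.1]
  | none => mainOut pr

/-- **The tangled-surplus solver** on raw pure instances. -/
def starOut (pr : PRaw) : List Bool := starDispatch pr (findPar pr)

/-! ## Lengths -/

/-- The main answer has length `M`. -/
@[simp] theorem length_mainOutW (pr : PRaw) (ch : List (ℕ × ℕ × ℕ)) : (mainOutW pr ch).length = pr.2.1 := by
  simp [mainOutW]

/-- The answer has length `M`. -/
@[simp] theorem length_starOut (pr : PRaw) : (starOut pr).length = pr.2.1 := by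
  unfold starOut starDispatch
  cases findPar pr <;> simp [mainOut]

/-! ## The greedy fold -/

/-- The fold only appends. -/
theorem foldl_gstep_prefix (l acc : List (ℕ × ℕ × ℕ)) : ∃ t, l.foldl gstep acc = acc ++ t ∧ t.Sublist l := by
  induction l generalizing acc with
  | nil => exact ⟨[], by simp⟩
  | cons c l ih =>
    rw [List.foldl_cons]
    by_cases h : acc.any (fun q => clash q c) = true
    · obtain ⟨t, ht, hs⟩ := ih acc
      exact ⟨t, by rw [gstep, if_pos h, ht], hs.trans (List.sublist_cons_self c l)⟩
    · obtain ⟨t, ht, hs⟩ := ih (acc ++ [c])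
      refine ⟨c :: t, ?_, hs.cons_cons c⟩
      rw [gstep, if_neg h, ht, List.append_assoc, List.singleton_append]

/-- The greedy family is a sublist of the candidates. -/
theorem greedy_sublist (l : List (ℕ × ℕ × ℕ)) : (greedy l).Sublist l := by
  obtain ⟨t, ht, hs⟩ := foldl_gstep_prefix l []
  rw [greedy, ht, List.nil_append]; exact hs

/-- The fold keeps a clash-free accumulator clash-free. -/
theorem foldl_gstep_pairwise (l acc : List (ℕ × ℕ × ℕ)) (hacc : acc.Pairwise fun q c => clash q c = false) :
    (l.foldl gstep acc).Pairwise fun q c => clash q c = false := by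
  induction l generalizing acc with
  | nil => exact hacc
  | cons c l ih =>
    rw [List.foldl_cons]
    apply ih
    unfold gstep
    split
    · exact hacc
    · rename_i h
      rw [List.pairwise_append]
      refine ⟨hacc, List.pairwise_singleton _ _, fun q hq c' hc' => ?_⟩
      rw [List.mem_singleton] at hc'
      subst hc'
      have : ¬ clash q c' = true := fun hqc => h (List.any_eq_true.2 ⟨q, hq, hqc⟩)
      simpa using this

/-- **The chosen cherries are pairwise clash-free.** -/
theorem greedy_pairwise (l : List (ℕ × ℕ × ℕ)) : (greedy l).Pairwise fun q c => clash q c = false :=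
  foldl_gstep_pairwise l [] List.Pairwise.nil

/-- Every candidate clashes with a kept one (maximality), for the fold from any accumulator. -/
theorem exists_clash_foldl (l acc : List (ℕ × ℕ × ℕ)) {c : ℕ × ℕ × ℕ} (hc : c ∈ acc ∨ c ∈ l) :
    ∃ q ∈ l.foldl gstep acc, clash q c = true := by
  induction l generalizing acc with
  | nil =>
    rcases hc with hc | hc
    · exact ⟨c, hc, by simp [clash]⟩
    · exact absurd hc (List.not_mem_nil)
  | cons c' l ih =>
    rw [List.foldl_cons]
    rcases hc with hc | hc
    · apply ih
      left
      unfold gstep; split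
      · exact hc
      · exact List.mem_append_left _ hc
    · rcases List.mem_cons.1 hc with rfl | hc
      · by_cases h : acc.any (fun q => clash q c) = true
        · obtain ⟨q, hq, hqc⟩ := List.any_eq_true.1 h
          obtain ⟨t, ht, -⟩ := foldl_gstep_prefix l (gstep acc c)
          refine ⟨q, ?_, hqc⟩
          rw [ht, gstep, if_pos h]
          exact List.mem_append_left _ hq
        · apply ih
          left
          rw [gstep, if_neg h]
          exact List.mem_append_right _ (List.mem_singleton_self c)
      · exact ih _ (Or.inr hc)

/-- **Maximality**: every candidate clashes with some chosen cherry. -/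
theorem exists_clash_of_mem (l : List (ℕ × ℕ × ℕ)) {c : ℕ × ℕ × ℕ} (hc : c ∈ l) :
    ∃ q ∈ greedy l, clash q c = true :=
  exists_clash_foldl l [] (Or.inr hc)

end Summit.PneNP.PneNP.Theorems.Nc03CandStar
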